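import Mathlib
import Summits.HodgeConjecture.FermatCycles.HodgeFermatDescentBA

/-!
# THE DESCENT AT THE LEVELS 15N AND 21N — part 2: the descent at `21N`, the converses (lifts of the listed pairs), `¬ JP 3` (`HodgeFermat/DescentB.lean`; HF-G34b)

Tree copy (part 2 of 2) of the module `HodgeFermat/DescentB.lean` of the sibling cell's standalone package
`run/shared/lean/pub/pub-hodgefermat/lean/HodgeFermat/` (453 lines, sha256 `bcd014a39d36c708…`), source lines 247–453 (§§3–5:
`descent21`, `noCoincidence21`, `big15_facts`, `big21_facts`, `pair_lift`, `big15_lift`, `big21_lift`, `units39_lift15`, `units39_lift21`,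
`not_JP_three`); part 1 = `HodgeFermatDescentBA.lean` (§§0–2, with the module docstring quoted in full).
Filed by cell `pub-hfermat`, seat prover-1 gen-4, on the COORDINATOR KEEPER RULING of 2026-08-25 (gem sweep H1: take the
off-gate kernel theorem `thmFstar` through the gate).  The three forms of THEOREM F* named `thmFstar` in the sibling package are
on-gate since 2026-08-25/26 (`HodgeFermatThmFstar.lean` = F* at the prime levels, HF-G32, seat gen-0; `HodgeFermatThmFstarN.lean` =
F*(3N), HF-G33, gen-2; `HodgeFermatPropDPrimeNFinal.lean` = PROPOSITION D′(3N) and THE DESCENT, HF-G34, gen-3); this generation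
files the two remaining off-gate companions of that family: PROPOSITION D′ at the prime levels (the second theorem of the HF-G32
gate record itself, `DecodingDPrime` / `DPrimePrimeFinal`) and THE DESCENT AT THE LEVELS 15N AND 21N (HF-G34b, `DescentB` /
`DescentBFinal`).
The source module is the sibling's hub-checked module of record (pub-hodgefermat `CERT.md` l.993 / `GATE.md` l.2063, GATE HF-G34b;
records as in part 1); its declarations are copied VERBATIM.
Deviations from the source module, exhaustively: the `import` lines (part 1 instead of `HodgeFermat.PropDPrimeN`); this module docstring;
the `set_option`/namespace/`open` preamble (source l.42–51) is repeated at the top because the module is split; DEDUP RE-BINDING: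
the source's proof of `pair_lift` (l.381) names `PropDPrimeN.sameType_lift`, a theorem the tree holds under the name
`HodgeFermat.KRFree.FiveZ3Z1.sameType_scale` (`HodgeFermatFiveZ3Z1.lean`; the verbatim twin `PropDPrimeN.sameType_lift` of
`PropDPrimeN.lean` l.332–347 was deleted at landing as a gate duplicate, `HodgeFermatPropDPrimeNB.lean`) — re-bound here by the added
line `open HodgeFermat.KRFree.FiveZ3Z1 renaming sameType_scale → PropDPrimeN.sameType_lift` so that the use site stays
byte-identical; one-line docstring added (gate lint) to `big21_facts`.
Every other line — in particular every declaration's statement and proof — is byte-identical to the source.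
Trust base of this part: `descent21` / `noCoincidence21` carry the named hypotheses `KR6'`, `ThmUPlus'`, `Fstar` (theorems of the
tree) and `JP 21` (= (JP₂₁), not proved anywhere); the converses and `not_JP_three` are hypothesis-free; no `sorry`;
axioms = [propext, Classical.choice, Quot.sound].
HONEST FRAMING: explicit algebraic cycles for specific Hodge classes on Fermat/Delsarte varieties; residual open instances
listed; no claim on general Hodge.  (This file is arithmetic of CM types / finite combinatorics of the sibling's KR-free
programme; it claims nothing about cycles.)
-/

set_option autoImplicit false

namespace HodgeFermat.KRFree.DescentB

open HodgeFermat.KRFree.LemmaN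
open HodgeFermat.KRFree.TheoremUEq (ThmUPlus' Perm3)
open HodgeFermat.KRFree.TheoremZ3U (KR6')
open HodgeFermat.KRFree.CoincFull (classes15 classes21 classes39 InClass fullAt_15 fullAt_21)
open HodgeFermat.KRFree.PropDPrimeN (Fstar units39 Share exists_gcd reduce perm3_modEq share_common perm3_mem
  not_dvd_of_primeFactors eleven_le)

open HodgeFermat.KRFree.FiveZ3Z1 renaming sameType_scale → PropDPrimeN.sameType_lift

/-! ## 3. The descent at the levels 21N -/

/-- **THE DESCENT AT LEVEL 21N** (under `KR6'`, `ThmUPlus'`, `Fstar` and `(JP₂₁)`): as `descent15` with `7` for `5`, reduced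
level `39` (factor `7g`, `N = 13·g`) or `21` (factor `N`, one of the two big classes `big21`). -/
theorem descent21 (hKR : KR6') (hUplus : ThmUPlus') (hF : Fstar) (hJP : JP 21) {N : ℕ} (hN : 0 < N)
    (hsq : Squarefree N) (h11 : ∀ p ∈ N.primeFactors, 11 ≤ p) {a b c a' b' c' : ℕ}
    (hs : 21 * N ∣ a + b + c) (ha : ¬ 21 * N ∣ a) (hb : ¬ 21 * N ∣ b) (hc : ¬ 21 * N ∣ c)
    (hs' : 21 * N ∣ a' + b' + c') (ha' : ¬ 21 * N ∣ a') (hb' : ¬ 21 * N ∣ b') (hc' : ¬ 21 * N ∣ c')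
    (hD : ∀ u v, (u = a ∨ u = b ∨ u = c) → (v = a' ∨ v = b' ∨ v = c') → ¬ u ≡ v [MOD 21 * N])
    (hH : SameType (21 * N) (a, b, c) (a', b', c')) :
    (∃ g, N = 13 * g ∧ 7 * g ∣ a ∧ 7 * g ∣ b ∧ 7 * g ∣ c ∧ 7 * g ∣ a' ∧ 7 * g ∣ b' ∧ 7 * g ∣ c' ∧
      ∃ cl ∈ units39, InClass cl (a / (7 * g) % 39) (b / (7 * g) % 39) (c / (7 * g) % 39) ∧
        InClass cl (a' / (7 * g) % 39) (b' / (7 * g) % 39) (c' / (7 * g) % 39)) ∨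
    (N ∣ a ∧ N ∣ b ∧ N ∣ c ∧ N ∣ a' ∧ N ∣ b' ∧ N ∣ c' ∧
      ∃ cl ∈ big21, InClass cl (a / N % 21) (b / N % 21) (c / N % 21) ∧
        InClass cl (a' / N % 21) (b' / N % 21) (c' / N % 21)) := by
  obtain ⟨-, hsqL, hoddL⟩ := level_facts hN hsq h11
  obtain ⟨g, hgM, ⟨a₁, rfl⟩, ⟨b₁, rfl⟩, ⟨c₁, rfl⟩, ⟨a₂, rfl⟩, ⟨b₂, rfl⟩, ⟨c₂, rfl⟩, hmax⟩ :=
    exists_gcd (21 * N) a b c a' b' c'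
  obtain ⟨ℓ, hℓ⟩ := hgM
  have hg : 0 < g := Nat.pos_of_ne_zero (by rintro rfl; omega)
  have hℓpos : 0 < ℓ := Nat.pos_of_ne_zero (by rintro rfl; omega)
  have hℓdvd : ℓ ∣ 21 * N := ⟨g, by rw [hℓ, mul_comm]⟩
  rw [hℓ] at hs ha hb hc hs' ha' hb' hc' hD hH
  obtain ⟨hs₁, ha₁, hb₁, hc₁, hs₂, ha₂, hb₂, hc₂, hD₁, hH₁⟩ := reduce hg hℓpos hs ha hb hc hs' ha' hb' hc' hD hH
  have hJ₁ : ∀ q, Nat.Prime q → q ∣ ℓ → q ∣ a₁ → q ∣ b₁ → q ∣ c₁ → q ∣ a₂ → q ∣ b₂ → q ∣ c₂ → False := by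
    intro q hq hqℓ qa qb qc qa' qb' qc'
    have hdvd : g * q ∣ g := hmax (g * q) (by rw [hℓ]; exact Nat.mul_dvd_mul_left g hqℓ)
      (Nat.mul_dvd_mul_left g qa) (Nat.mul_dvd_mul_left g qb) (Nat.mul_dvd_mul_left g qc)
      (Nat.mul_dvd_mul_left g qa') (Nat.mul_dvd_mul_left g qb') (Nat.mul_dvd_mul_left g qc')
    have h1 := Nat.le_of_dvd hg hdvd
    have h2 := Nat.mul_le_mul_left g hq.two_le
    omega
  obtain ⟨⟨ℓ', rfl⟩, -⟩ := ThreeFinal.corollaryM_final hKR hUplus ℓ a₁ b₁ c₁ a₂ b₂ c₂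
    (hsqL.squarefree_of_dvd hℓdvd) (hoddL.of_dvd_nat hℓdvd) hs₁ ha₁ hb₁ hc₁ hs₂ ha₂ hb₂ hc₂ hJ₁ hD₁ hH₁
  by_cases h7 : 7 ∣ ℓ'
  · obtain ⟨ℓ₁, rfl⟩ := h7
    have e : 3 * (7 * ℓ₁) = 21 * ℓ₁ := by ring
    rw [e] at hs₁ ha₁ hb₁ hc₁ hs₂ ha₂ hb₂ hc₂ hD₁ hH₁ hJ₁ hℓdvd hℓ
    have hℓ₁N : ℓ₁ ∣ N := Nat.dvd_of_mul_dvd_mul_left (by norm_num : 0 < 21) hℓdvd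
    have hℓ₁ : 0 < ℓ₁ := Nat.pos_of_dvd_of_pos hℓ₁N hN
    by_cases h1 : ℓ₁ = 1
    · subst h1
      right
      have hgN : g = N := by omega
      subst hgN
      refine ⟨Dvd.intro _ rfl, Dvd.intro _ rfl, Dvd.intro _ rfl, Dvd.intro _ rfl, Dvd.intro _ rfl, Dvd.intro _ rfl, ?_⟩
      simp only [Nat.mul_div_cancel_left _ hg]
      have e21 : (21 : ℕ) * 1 = 21 := rfl
      rw [e21] at hs₁ ha₁ hb₁ hc₁ hs₂ ha₂ hb₂ hc₂ hD₁ hH₁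
      rcases fullAt_21 a₁ b₁ c₁ a₂ b₂ c₂ ha₁ hb₁ hc₁ ha₂ hb₂ hc₂ hs₁ hs₂ hH₁ with hP | ⟨cl, hcl, hT, hT'⟩
      · obtain ⟨v, hv, hav⟩ := perm3_modEq hP
        exact absurd hav (hD₁ a₁ v (Or.inl rfl) hv)
      · refine ⟨cl, ?_, hT, hT'⟩
        by_contra hu
        obtain ⟨T, hTcl, hpT⟩ := hT
        obtain ⟨T', hT'cl, hpT'⟩ := hT'
        obtain ⟨w, hw, hw'⟩ := share_common (classes21_share cl hcl hu T hTcl T' hT'cl)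
        rcases perm3_mem hpT hw with rfl | rfl | rfl <;> rcases perm3_mem hpT' hw' with h | h | h
        all_goals exact hD₁ _ _ (by simp) (by simp) h
    · exfalso
      exact hJP ℓ₁ a₁ b₁ c₁ a₂ b₂ c₂ (by omega) (hsq.squarefree_of_dvd hℓ₁N) (primeFactors_of_dvd hN h11 hℓ₁N)
        hs₁ ha₁ hb₁ hc₁ hs₂ ha₂ hb₂ hc₂ hJ₁ hD₁ hH₁
  · have hℓ'7N : ℓ' ∣ 7 * N :=
      Nat.dvd_of_mul_dvd_mul_left (by norm_num : 0 < 3) (by rwa [show 21 * N = 3 * (7 * N) by ring] at hℓdvd)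
    have hcop : Nat.Coprime ℓ' 7 :=
      (Nat.Coprime.symm ((Nat.Prime.coprime_iff_not_dvd (by norm_num : Nat.Prime 7)).mpr h7))
    have hℓ'N : ℓ' ∣ N := hcop.dvd_of_dvd_mul_left hℓ'7N
    obtain ⟨h13, cl, hcl, hT, hT'⟩ := fstar_branch hKR hUplus hF hN hsq h11 hℓ'N hs₁ ha₁ hb₁ hc₁ hs₂ ha₂ hb₂ hc₂
      hJ₁ hD₁ hH₁
    subst h13
    left
    have h7g : 7 ∣ g := by omega
    obtain ⟨g₀, rfl⟩ := h7g
    refine ⟨g₀, by omega, Dvd.intro _ rfl, Dvd.intro _ rfl, Dvd.intro _ rfl, Dvd.intro _ rfl, Dvd.intro _ rfl,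
      Dvd.intro _ rfl, ?_⟩
    simp only [Nat.mul_div_cancel_left _ hg]
    exact ⟨cl, hcl, hT, hT'⟩

/-- **COROLLARY.**  If `13 ∤ N`, every disjoint coincidence at level `21N` is `N` times a level-21 pair of a big class. -/
theorem noCoincidence21 (hKR : KR6') (hUplus : ThmUPlus') (hF : Fstar) (hJP : JP 21) {N : ℕ} (hN : 0 < N)
    (hsq : Squarefree N) (h11 : ∀ p ∈ N.primeFactors, 11 ≤ p) (h13 : ¬ 13 ∣ N) {a b c a' b' c' : ℕ}
    (hs : 21 * N ∣ a + b + c) (ha : ¬ 21 * N ∣ a) (hb : ¬ 21 * N ∣ b) (hc : ¬ 21 * N ∣ c)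
    (hs' : 21 * N ∣ a' + b' + c') (ha' : ¬ 21 * N ∣ a') (hb' : ¬ 21 * N ∣ b') (hc' : ¬ 21 * N ∣ c')
    (hD : ∀ u v, (u = a ∨ u = b ∨ u = c) → (v = a' ∨ v = b' ∨ v = c') → ¬ u ≡ v [MOD 21 * N])
    (hH : SameType (21 * N) (a, b, c) (a', b', c')) :
    N ∣ a ∧ N ∣ b ∧ N ∣ c ∧ N ∣ a' ∧ N ∣ b' ∧ N ∣ c' ∧
      ∃ cl ∈ big21, InClass cl (a / N % 21) (b / N % 21) (c / N % 21) ∧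
        InClass cl (a' / N % 21) (b' / N % 21) (c' / N % 21) := by
  rcases descent21 hKR hUplus hF hJP hN hsq h11 hs ha hb hc hs' ha' hb' hc' hD hH with ⟨g, hg, -⟩ | h
  · exact absurd ⟨g, hg⟩ h13
  · exact h

/-! ## 4. The converses: lifts of the listed pairs -/

/-- kernel facts about the big classes: zero sums and entries in range -/
theorem big15_facts : ∀ cl ∈ big15, ∀ T ∈ cl,
    15 ∣ T.1 + T.2.1 + T.2.2 ∧ 0 < T.1 ∧ T.1 < 15 ∧ 0 < T.2.1 ∧ T.2.1 < 15 ∧ 0 < T.2.2 ∧ T.2.2 < 15 := by decide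

/-- kernel facts about the big classes at `21`: zero sums and entries in range -/
theorem big21_facts : ∀ cl ∈ big21, ∀ T ∈ cl,
    21 ∣ T.1 + T.2.1 + T.2.2 ∧ 0 < T.1 ∧ T.1 < 21 ∧ 0 < T.2.1 ∧ T.2.1 < 21 ∧ 0 < T.2.2 ∧ T.2.2 < 21 := by decide

/-- the generic lift: `g` times a disjoint pair of zero-sum triples of residues in `[1, n-1]` with the same CM type at level `n`
is a disjoint coincidence at level `n·g` -/
lemma pair_lift {n g : ℕ} (hg : 0 < g) {x y z x' y' z' : ℕ}
    (hs : n ∣ x + y + z) (hx0 : 0 < x) (hx : x < n) (hy0 : 0 < y) (hy : y < n) (hz0 : 0 < z) (hz : z < n)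
    (hs' : n ∣ x' + y' + z') (hx0' : 0 < x') (hx' : x' < n) (hy0' : 0 < y') (hy' : y' < n) (hz0' : 0 < z')
    (hz' : z' < n) (hd : ¬ Share (x, y, z) (x', y', z')) (hST : SameType n (x, y, z) (x', y', z')) :
    n * g ∣ g * x + g * y + g * z ∧ ¬ n * g ∣ g * x ∧ ¬ n * g ∣ g * y ∧ ¬ n * g ∣ g * z ∧
    n * g ∣ g * x' + g * y' + g * z' ∧ ¬ n * g ∣ g * x' ∧ ¬ n * g ∣ g * y' ∧ ¬ n * g ∣ g * z' ∧
    (∀ u v, (u = g * x ∨ u = g * y ∨ u = g * z) → (v = g * x' ∨ v = g * y' ∨ v = g * z') → ¬ u ≡ v [MOD n * g]) ∧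
    SameType (n * g) (g * x, g * y, g * z) (g * x', g * y', g * z') := by
  have e : n * g = g * n := mul_comm _ _
  have lt : ∀ w, w < n → g * w < n * g := fun w hw => by
    rw [e]; exact Nat.mul_lt_mul_of_pos_left hw hg
  have nd : ∀ w, 0 < w → w < n → ¬ n * g ∣ g * w := fun w hw0 hw hdvd =>
    absurd (Nat.le_of_dvd (Nat.mul_pos hg hw0) hdvd) (not_le.mpr (lt w hw))
  have zs : ∀ p q r, n ∣ p + q + r → n * g ∣ g * p + g * q + g * r := fun p q r h => by
    rw [e, show g * p + g * q + g * r = g * (p + q + r) by ring]; exact mul_dvd_mul_left g h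
  refine ⟨zs _ _ _ hs, nd _ hx0 hx, nd _ hy0 hy, nd _ hz0 hz, zs _ _ _ hs', nd _ hx0' hx', nd _ hy0' hy', nd _ hz0' hz',
    ?_, ?_⟩
  · intro u v hu hv huv
    have hu' : u < n * g := by
      rcases hu with rfl | rfl | rfl
      exacts [lt _ hx, lt _ hy, lt _ hz]
    have hv' : v < n * g := by
      rcases hv with rfl | rfl | rfl
      exacts [lt _ hx', lt _ hy', lt _ hz']
    have huv' : u = v := by
      have h := huv; unfold Nat.ModEq at h; rwa [Nat.mod_eq_of_lt hu', Nat.mod_eq_of_lt hv'] at h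
    apply hd
    unfold Share; dsimp only
    rcases hu with rfl | rfl | rfl <;> rcases hv with rfl | rfl | rfl <;>
      have hh := Nat.eq_of_mul_eq_mul_left hg huv' <;> omega
  · rw [e]; exact PropDPrimeN.sameType_lift hg hST

/-- **CONVERSE AT 15**: `g` times a DISJOINT pair from one class of `big15` is a disjoint coincidence at level `15g`. -/
theorem big15_lift {g : ℕ} (hg : 0 < g) {cl : List CoincFull.Tri} (hcl : cl ∈ big15) {x y z x' y' z' : ℕ}
    (hT : (x, y, z) ∈ cl) (hT' : (x', y', z') ∈ cl) (hd : ¬ Share (x, y, z) (x', y', z')) :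
    15 * g ∣ g * x + g * y + g * z ∧ ¬ 15 * g ∣ g * x ∧ ¬ 15 * g ∣ g * y ∧ ¬ 15 * g ∣ g * z ∧
    15 * g ∣ g * x' + g * y' + g * z' ∧ ¬ 15 * g ∣ g * x' ∧ ¬ 15 * g ∣ g * y' ∧ ¬ 15 * g ∣ g * z' ∧
    (∀ u v, (u = g * x ∨ u = g * y ∨ u = g * z) → (v = g * x' ∨ v = g * y' ∨ v = g * z') → ¬ u ≡ v [MOD 15 * g]) ∧
    SameType (15 * g) (g * x, g * y, g * z) (g * x', g * y', g * z') := by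
  obtain ⟨hs, hx0, hx, hy0, hy, hz0, hz⟩ := big15_facts cl hcl _ hT
  obtain ⟨hs', hx0', hx', hy0', hy', hz0', hz'⟩ := big15_facts cl hcl _ hT'
  exact pair_lift hg hs hx0 hx hy0 hy hz0 hz hs' hx0' hx' hy0' hy' hz0' hz' hd
    (CoincFull.classes15_sameType (big15_sub cl hcl) hT hT')

/-- **CONVERSE AT 21**: `g` times a DISJOINT pair from one class of `big21` is a disjoint coincidence at level `21g`. -/
theorem big21_lift {g : ℕ} (hg : 0 < g) {cl : List CoincFull.Tri} (hcl : cl ∈ big21) {x y z x' y' z' : ℕ}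
    (hT : (x, y, z) ∈ cl) (hT' : (x', y', z') ∈ cl) (hd : ¬ Share (x, y, z) (x', y', z')) :
    21 * g ∣ g * x + g * y + g * z ∧ ¬ 21 * g ∣ g * x ∧ ¬ 21 * g ∣ g * y ∧ ¬ 21 * g ∣ g * z ∧
    21 * g ∣ g * x' + g * y' + g * z' ∧ ¬ 21 * g ∣ g * x' ∧ ¬ 21 * g ∣ g * y' ∧ ¬ 21 * g ∣ g * z' ∧
    (∀ u v, (u = g * x ∨ u = g * y ∨ u = g * z) → (v = g * x' ∨ v = g * y' ∨ v = g * z') → ¬ u ≡ v [MOD 21 * g]) ∧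
    SameType (21 * g) (g * x, g * y, g * z) (g * x', g * y', g * z') := by
  obtain ⟨hs, hx0, hx, hy0, hy, hz0, hz⟩ := big21_facts cl hcl _ hT
  obtain ⟨hs', hx0', hx', hy0', hy', hz0', hz'⟩ := big21_facts cl hcl _ hT'
  exact pair_lift hg hs hx0 hx hy0 hy hz0 hz hs' hx0' hx' hy0' hy' hz0' hz' hd
    (CoincFull.classes21_sameType (big21_sub cl hcl) hT hT')

/-- the level-39 unit pairs lifted by `5g` to level `15·(13g)` -/
theorem units39_lift15 {g : ℕ} (hg : 0 < g) {cl : List CoincFull.Tri} (hcl : cl ∈ units39) {x y z x' y' z' : ℕ}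
    (hT : (x, y, z) ∈ cl) (hT' : (x', y', z') ∈ cl) (hne : (x, y, z) ≠ (x', y', z')) :
    15 * (13 * g) ∣ 5 * g * x + 5 * g * y + 5 * g * z ∧
    ¬ 15 * (13 * g) ∣ 5 * g * x ∧ ¬ 15 * (13 * g) ∣ 5 * g * y ∧ ¬ 15 * (13 * g) ∣ 5 * g * z ∧
    15 * (13 * g) ∣ 5 * g * x' + 5 * g * y' + 5 * g * z' ∧
    ¬ 15 * (13 * g) ∣ 5 * g * x' ∧ ¬ 15 * (13 * g) ∣ 5 * g * y' ∧ ¬ 15 * (13 * g) ∣ 5 * g * z' ∧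
    (∀ u v, (u = 5 * g * x ∨ u = 5 * g * y ∨ u = 5 * g * z) → (v = 5 * g * x' ∨ v = 5 * g * y' ∨ v = 5 * g * z') →
      ¬ u ≡ v [MOD 15 * (13 * g)]) ∧
    SameType (15 * (13 * g)) (5 * g * x, 5 * g * y, 5 * g * z) (5 * g * x', 5 * g * y', 5 * g * z') := by
  rw [show 15 * (13 * g) = 3 * (13 * (5 * g)) by ring]
  exact PropDPrimeN.units39_lift (by omega) hcl hT hT' hne

/-- the level-39 unit pairs lifted by `7g` to level `21·(13g)` -/
theorem units39_lift21 {g : ℕ} (hg : 0 < g) {cl : List CoincFull.Tri} (hcl : cl ∈ units39) {x y z x' y' z' : ℕ}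
    (hT : (x, y, z) ∈ cl) (hT' : (x', y', z') ∈ cl) (hne : (x, y, z) ≠ (x', y', z')) :
    21 * (13 * g) ∣ 7 * g * x + 7 * g * y + 7 * g * z ∧
    ¬ 21 * (13 * g) ∣ 7 * g * x ∧ ¬ 21 * (13 * g) ∣ 7 * g * y ∧ ¬ 21 * (13 * g) ∣ 7 * g * z ∧
    21 * (13 * g) ∣ 7 * g * x' + 7 * g * y' + 7 * g * z' ∧
    ¬ 21 * (13 * g) ∣ 7 * g * x' ∧ ¬ 21 * (13 * g) ∣ 7 * g * y' ∧ ¬ 21 * (13 * g) ∣ 7 * g * z' ∧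
    (∀ u v, (u = 7 * g * x ∨ u = 7 * g * y ∨ u = 7 * g * z) → (v = 7 * g * x' ∨ v = 7 * g * y' ∨ v = 7 * g * z') →
      ¬ u ≡ v [MOD 21 * (13 * g)]) ∧
    SameType (21 * (13 * g)) (7 * g * x, 7 * g * y, 7 * g * z) (7 * g * x', 7 * g * y', 7 * g * z') := by
  rw [show 21 * (13 * g) = 3 * (13 * (7 * g)) by ring]
  exact PropDPrimeN.units39_lift (by omega) hcl hT hT' hne

/-! ## 5. The hypothesis is level-sensitive: (JP₃) is false -/

/-- `JP 3` fails: at `N = 13` the unit pair `(1, 16, 22) ∼ (2, 5, 32)` of level `39` is a disjoint, jointly primitive coincidence. -/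
theorem not_JP_three : ¬ JP 3 := by
  intro h
  have hsq : Squarefree 13 := (by norm_num : Nat.Prime 13).squarefree
  have h11 : ∀ p ∈ (13 : ℕ).primeFactors, 11 ≤ p := by
    intro p hp
    rw [Nat.Prime.primeFactors (by norm_num)] at hp
    simp at hp; omega
  have hST : SameType (3 * 13) ((1 : ℕ), (16 : ℕ), (22 : ℕ)) ((2 : ℕ), (5 : ℕ), (32 : ℕ)) :=
    CoincFull.classes39_sameType (cl := [(1, 16, 22), (2, 5, 32), (4, 10, 25), (8, 11, 20)]) (by decide) (by decide)
      (by decide)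
  refine h 13 1 16 22 2 5 32 (by norm_num) hsq h11 (by norm_num) (by norm_num) (by norm_num) (by norm_num)
    (by norm_num) (by norm_num) (by norm_num) (by norm_num) ?_ ?_ hST
  · intro q hq _ h1 _ _ _ _ _
    exact (Nat.Prime.one_lt hq).ne' (Nat.dvd_one.mp h1)
  · intro u v hu hv
    rcases hu with rfl | rfl | rfl <;> rcases hv with rfl | rfl | rfl <;> decide

end HodgeFermat.KRFree.DescentB
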